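import Mathlib.FieldTheory.Galois.Infinite
import Mathlib.FieldTheory.KummerPolynomial
import Literature.AnabelianGeometry.EtaleTheta.SettingModelTateOrigin
import HarnessLib

/-!
# SHEAR RIGIDITY of the Tate-module clause at stage 2: `IsTateOrigin` at `ThetaSetting.modelχq p i j hj` forces
# every odd prime `q` NOT to divide the shear exponent `j` (so `j = ± 2^a`, `a ≥ 1`); in particular `j = 0` fails

abc-iut cell, layer L2, R78 cluster STAGE 2 (integrator abc-iut-L6-d6), seat abc-iut-w5-d051 (gen 3; author of the
clause text TM / `IsTateOrigin` and of its stage-2 inhabitant `SettingModelTateOrigin.modelχq_isTateOrigin`, `j = 2`).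
Mochizuki, *The étale theta function …*, Publ. RIMS **45** (2009) [EtTh], §1 p. 13 [cite: MochizukiEtTh2009, §1 p.13]:
«`G_{K_N}` acts trivially on `(Δ^tp_X)^ell/N·(Δ^tp_Y)^ell`», `K_N = K(ζ_N, q_X^{1/N})` — i.e. the commutator of a lift
of `1 ∈ Z` with `σ` IS the Kummer class of `q_X`.

abc-iut-L2-t5's stage-2 record `ThetaSetting.modelχq p i j (hj : Even j)` carries a free even SHEAR EXPONENT `j`
(`a ↦ Inn(b^{κ_p^i})(a · b^{κ_p^j})`, `q_X = p²`). The print-faithful clause for every `N` detects it: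

* §1 general-`j` bookkeeping (the `j = 2` versions are in `SettingModelTateOrigin`): `toEll_modelχqj_apply`,
  `toEll_modelχqj_eq_iff`, `inl_mem_dtpY_modelχqj_iff`, `inl_bPowGfp_mem_dtpYqj`, and the `N`-th POWER CRITERION
  `toEll_inl_mem_ellPowersYj` (`ê = 1 ∧ ê_b ≡ 0 (N) ⇒ (inl q)^ell ∈ N·(Δ^tp_Y)^ell`);
* §2 Galois input for an odd prime `q`: `exists_gal_fix_zeta_move_primeRoot` — some `σ ∈ G_{ℚ_p}` fixes a primitive
  `q`-th root of unity `ζ` and moves any `q`-th root `r` of `p²` (`[ℚ_p(r) : ℚ_p] = q` by the irreducibility of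
  `X^q − p²` — prime degree, `p²` no `q`-th power in `ℚ_p` since `q ∤ 2` — does not fit under `[ℚ_p(ζ) : ℚ_p] ≤ q − 1`);
* §3 **`modelχq_not_isTateOrigin_of_dvd_of_gal`** (core: `N ∣ j` + the level-`N` Galois input ⇒ ✗) and
  **`modelχq_not_isTateOrigin_of_prime_dvd`** — for every odd prime `q ∣ j` (any `i`, any even `j`),
  `¬ (ThetaSetting.modelχq p i j hj).IsTateOrigin`. At level `N = q`, given clause data `(y₁, z, ζ, r)`: take `σ`
  fixing `ζ` and moving `r`, `σ r = ζ^m r` with `0 < m < q`, `g := inr σ`, `z = z_a · y₀` (`z_a = inl(η a, 1)`,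
  `y₀ ∈ Δ^tp_Y`). At stage 2 `g z_a g⁻¹ = z_a · w` with `w = inl((η a,1)⁻¹ · σ·(η a,1))`, `ê(w) = 1`,
  `ê_b(w) = κ_p(σ)^j ≡ 0 (q)` BECAUSE `q ∣ j` — so `w^ell ∈ q·(Δ^tp_Y)^ell` by the power criterion; clause (b) with
  `k = 1` puts `(g y₀ g⁻¹)^ell (y₀^ell)⁻¹` there too, and clause (c) then forces `(ȳ₁^m)⁻¹ ∈ q·(Δ^tp_Y)^ell`, i.e.
  `q ∣ m` by (a′) — contradiction (the stage-1 argument of `SettingModelChiOriginProfile.modelχ_not_isTateOrigin`,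
  which is the case `j = 0`, `i = 0`, `q = 3`);
* §4 consequences: `modelχq_zero_not_isTateOrigin` (the UNSHEARED inner-twisted models `j = 0`, every `i`, fail —
  stage 1 persists under `Inn(b^{κ^i})`), `eq_two_of_prime_dvd_of_isTateOrigin`, `ne_zero_of_isTateOrigin`,
  **`natAbs_eq_two_pow_of_isTateOrigin`** (`IsTateOrigin ⇒ |j| = 2^a` with `a ≥ 1`), and the summary
  `modelχq_isTateOrigin_two_and_rigidity` (with `modelχq_isTateOrigin`: `j = 2` ✓; odd prime factors ✗; `j = 0` ✗).
  The residual family `j = ±2^a`, `a ≥ 2` needs the level-`4` Galois input (`(p²)^{1/4} ∉ ℚ_p(ζ_4)`), not in this file.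

READING: the Tate-module clause READS THE VALUATION OF THE SHEAR off the group theory — the Kummer class of `q_X`
(«`G_{K_N}` acts trivially …») is `2κ_p`, and the commutator of the lift of `1 ∈ Z` is `jκ_p`; they agree mod every
odd prime only if `j/2` has no odd prime factor. PROOF-ONLY (no definition, no named fact). Semi-synthetic model =
consistency evidence only; nothing of [EtTh] asserted for genuine tempered fundamental groups; no side is taken on
[IUTchIII] Cor. 3.12; typed ≠ proved.
-/

noncomputable section

namespace Literature.AnabelianGeometry.EtaleTheta.SettingModel

open Literature.AnabelianGeometry.SemiGraphs Thm16Sub Function Topology Polynomial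

/-! ### 2. Galois input at an odd prime level `q` -/

section Galois

variable (p : ℕ) [Fact p.Prime]

/-- `p² ∈ ℚ_p` is not a `q`-th power for a prime `q ≠ 2`: `q · v(x) = 2` forces `q ∣ 2`.
[cite: Gouvea1993PadicNumbers, Prop 6.3.11] -/
private theorem padic_pow_prime_ne_sq {q : ℕ} (hq : q.Prime) (hq2 : q ≠ 2) (x : ℚ_[p]) :
    x ^ q ≠ (p : ℚ_[p]) ^ 2 := by
  intro h
  have hp : (p : ℚ_[p]) ≠ 0 := Nat.cast_ne_zero.mpr (Fact.out : p.Prime).ne_zero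
  have hx : x ≠ 0 := by
    rintro rfl
    rw [zero_pow hq.ne_zero] at h
    exact pow_ne_zero 2 hp h.symm
  have hv := congrArg Padic.valuation h
  rw [Padic.valuation_pow, Padic.valuation_pow, Padic.valuation_p, mul_one] at hv
  have hdvd : (q : ℤ) ∣ (2 : ℕ) := ⟨x.valuation, by rw [← hv]⟩
  have hq2' : q ∣ 2 := by exact_mod_cast hdvd
  exact hq2 ((Nat.prime_dvd_prime_iff_eq hq Nat.prime_two).mp hq2')

/-- `X^q − p²` is the minimal polynomial of any `q`-th root `r` of `p²` in `ℚ̄_p` (`q ≠ 2` prime), so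
`[ℚ_p(r) : ℚ_p] = q`. [cite: MilneFT2022, Prop 1.25] -/
private theorem finrank_adjoin_primeRoot {q : ℕ} (hq : q.Prime) (hq2 : q ≠ 2) {r : PadicAlgCl p}
    (hr : r ^ q = ((p : ℕ) : PadicAlgCl p) ^ 2) :
    Module.finrank ℚ_[p] (IntermediateField.adjoin ℚ_[p] {r}) = q := by
  have hint : IsIntegral ℚ_[p] r := Algebra.IsIntegral.isIntegral r
  let P : ℚ_[p][X] := X ^ q - C ((p : ℚ_[p]) ^ 2)
  have hPm : P.Monic := monic_X_pow_sub_C _ hq.ne_zero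
  have hPdeg : P.natDegree = q := natDegree_X_pow_sub_C
  have hPr : Polynomial.aeval r P = 0 := by
    simp only [P, map_sub, map_pow, aeval_X, map_natCast]
    rw [hr, sub_self]
  have hirr : Irreducible P := X_pow_sub_C_irreducible_of_prime hq fun b => padic_pow_prime_ne_sq p hq hq2 b
  have hmin : P = minpoly ℚ_[p] r := minpoly.eq_of_irreducible_of_monic hirr hPr hPm
  rw [IntermediateField.adjoin.finrank hint, ← hmin, hPdeg]

/-- For a primitive `q`-th root of unity `ζ ∈ ℚ̄_p` (`q` prime), `[ℚ_p(ζ) : ℚ_p] ≤ q − 1` (`ζ` is a root of `Φ_q`).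
[cite: MilneFT2022, Prop 1.25] -/
private theorem finrank_adjoin_zeta_le_of_prime {q : ℕ} (hq : q.Prime) {ζ : PadicAlgCl p}
    (hζ : IsPrimitiveRoot ζ q) : Module.finrank ℚ_[p] (IntermediateField.adjoin ℚ_[p] {ζ}) ≤ q - 1 := by
  have hint : IsIntegral ℚ_[p] ζ := Algebra.IsIntegral.isIntegral ζ
  have hroot : Polynomial.aeval ζ (cyclotomic q ℚ_[p]) = 0 := by
    rw [aeval_def, eval₂_eq_eval_map, map_cyclotomic, ← IsRoot.def]
    exact hζ.isRoot_cyclotomic hq.pos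
  have hdeg := minpoly.min ℚ_[p] ζ (cyclotomic.monic q ℚ_[p]) hroot
  rw [IntermediateField.adjoin.finrank hint]
  calc (minpoly ℚ_[p] ζ).natDegree ≤ (cyclotomic q ℚ_[p]).natDegree := natDegree_le_natDegree hdeg
    _ = q - 1 := by rw [natDegree_cyclotomic, Nat.totient_prime hq]

/-- A `q`-th root of `p²` does not lie in `ℚ_p(ζ_q)` (`q ≠ 2` prime: degree `q` does not fit under degree `≤ q − 1`).
[cite: MilneFT2022, Prop 1.25] -/
private theorem primeRoot_not_mem_adjoin_zeta {q : ℕ} (hq : q.Prime) (hq2 : q ≠ 2) {ζ r : PadicAlgCl p}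
    (hζ : IsPrimitiveRoot ζ q) (hr : r ^ q = ((p : ℕ) : PadicAlgCl p) ^ 2) :
    r ∉ IntermediateField.adjoin ℚ_[p] {ζ} := by
  intro hmem
  have hζint : IsIntegral ℚ_[p] ζ := Algebra.IsIntegral.isIntegral ζ
  haveI := IntermediateField.adjoin.finiteDimensional hζint
  have hle : IntermediateField.adjoin ℚ_[p] {r} ≤ IntermediateField.adjoin ℚ_[p] {ζ} :=
    IntermediateField.adjoin_simple_le_iff.mpr hmem
  have h := IntermediateField.finrank_le_of_le_right hle
  rw [finrank_adjoin_primeRoot p hq hq2 hr] at h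
  have h2 := finrank_adjoin_zeta_le_of_prime p hq hζ
  have := hq.two_le
  omega

/-- **Some `σ ∈ G_{ℚ_p}` fixes `ζ_q` and moves `(p²)^{1/q}`** (`q ≠ 2` prime; Galois correspondence for `ℚ̄_p/ℚ_p` at
the closed subgroup `G_{ℚ_p(ζ_q)}`). [cite: MilneFT2022, Thm 7.13] -/
theorem exists_gal_fix_zeta_move_primeRoot {q : ℕ} (hq : q.Prime) (hq2 : q ≠ 2) {ζ r : PadicAlgCl p}
    (hζ : IsPrimitiveRoot ζ q) (hr : r ^ q = ((p : ℕ) : PadicAlgCl p) ^ 2) : ∃ σ : GQp p, σ ζ = ζ ∧ σ r ≠ r := by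
  by_contra hall
  push Not at hall
  haveI : IsGalois ℚ_[p] (PadicAlgCl p) := {}
  have hmem : r ∈ IntermediateField.fixedField (IntermediateField.adjoin ℚ_[p] {ζ}).fixingSubgroup := by
    rw [IntermediateField.mem_fixedField_iff]
    intro σ hσ
    have hσζ : σ ζ = ζ :=
      (IntermediateField.mem_fixingSubgroup_iff _ σ).mp hσ ζ (IntermediateField.mem_adjoin_simple_self _ ζ)
    exact hall σ hσζ
  rw [InfiniteGalois.fixedField_fixingSubgroup] at hmem
  exact primeRoot_not_mem_adjoin_zeta p hq hq2 hζ hr hmem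

end Galois

section Model

variable (p : ℕ) [Fact p.Prime] (i j : ℤ) (hj : Even j)

/-! ### 1. General-`j` bookkeeping for `modelχq p i j hj` -/

/-- The ell-quotient map of the stage-2 model is the quotient by `CurveTheta.ellKer (curveχq p i j)`.
[cite: MochizukiEtTh2009, §1 p.12] -/
theorem toEll_modelχqj_apply (g : PiTpχq p i j) :
    toEll (ThetaSetting.modelχq p i j hj) g = QuotientGroup.mk' (CurveTheta.ellKer (curveχq p i j)) g := by
  change ((CurveTheta.thetaToEll (curveχq p i j)).comp (CurveTheta.toTheta (curveχq p i j))) g = _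
  rw [CurveTheta.thetaToEll_comp]

/-- Equality in `(Π^tp_X)^ell` of the stage-2 model, general shear. [cite: MochizukiEtTh2009, §1 p.12] -/
theorem toEll_modelχqj_eq_iff (g h : PiTpχq p i j) :
    toEll (ThetaSetting.modelχq p i j hj) g = toEll (ThetaSetting.modelχq p i j hj) h ↔
      g⁻¹ * h ∈ CurveTheta.ellKer (curveχq p i j) := by
  rw [toEll_modelχqj_apply, toEll_modelχqj_apply, QuotientGroup.mk'_apply, QuotientGroup.mk'_apply,
    QuotientGroup.eq]

/-- `inl q ∈ Δ^tp_Y` iff `pr₂ q = 0` (stage 2, general shear). [cite: MochizukiEtTh2009, §1 p.12] -/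
theorem inl_mem_dtpY_modelχqj_iff (q : Gfp) :
    (SemidirectProduct.inl q : PiTpχq p i j) ∈ (ThetaSetting.modelχq p i j hj).DtpY ↔ gfpSnd q = 1 := by
  change (SemidirectProduct.inl q : PiTpχq p i j) ∈
      ((tateTwistData₀ p i j).toZ).ker ⊓ (curveχq p i j).DeltaTemp ↔ _
  rw [Subgroup.mem_inf, MonoidHom.mem_ker, GfpTwistData₀.toZ_apply, SemidirectProduct.left_inl,
    mem_deltaTempχq_iff, SemidirectProduct.right_inl]
  exact ⟨fun h => h.1, fun h => ⟨h, rfl⟩⟩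

/-- `inl(b^t) ∈ Δ^tp_Y` (stage 2, general shear). [cite: MochizukiEtTh2009, §1 p.12] -/
theorem inl_bPowGfp_mem_dtpYqj (t : ZH) :
    (SemidirectProduct.inl (bPowGfp t) : PiTpχq p i j) ∈ (ThetaSetting.modelχq p i j hj).DtpY :=
  (inl_mem_dtpY_modelχqj_iff p i j hj _).mpr (gfpSnd_bPowGfp t)

/-- **POWER CRITERION (general shear).** If `ê(pr₁ q) = 1` and `ê_b(pr₁ q)` dies in `ℤ/N`, then
`(inl q)^ell ∈ N·(Δ^tp_Y)^ell`. [cite: MochizukiEtTh2009, §1 p.13] -/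
theorem toEll_inl_mem_ellPowersYj (N : ℕ+) {q : Gfp} (hx : eHat (gfpFst q) = 1)
    (hy : ZHatLevel.level N (eHatB (gfpFst q)) = 1) :
    toEll (ThetaSetting.modelχq p i j hj) (SemidirectProduct.inl q) ∈ ellPowersY (ThetaSetting.modelχq p i j hj) N := by
  obtain ⟨t, ht⟩ := (ZHatLevel.level_eq_one_iff_exists_pow N _).mp hy
  set w : PiTpχq p i j := SemidirectProduct.inl (bPowGfp t) with hw
  have hwY : w ∈ (ThetaSetting.modelχq p i j hj).DtpY := inl_bPowGfp_mem_dtpYqj p i j hj t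
  have heq : toEll (ThetaSetting.modelχq p i j hj) (SemidirectProduct.inl q) =
      toEll (ThetaSetting.modelχq p i j hj) w ^ (N : ℕ) := by
    rw [← map_pow, eq_comm, toEll_modelχqj_eq_iff, hw, ← map_pow, ← map_inv, ← map_mul, inl_mem_ellKerχq_iff,
      map_mul, map_inv, map_pow, gfpFst_bPowGfp, map_mul, map_mul, map_inv, map_inv, map_pow, map_pow,
      eHat_bPow, eHatB_bPow, hx, ht, one_pow, inv_one, one_mul, inv_mul_cancel]
    exact ⟨rfl, rfl⟩
  rw [heq]
  exact Subgroup.subset_closure ⟨toEll (ThetaSetting.modelχq p i j hj) w, ⟨w, hwY, rfl⟩, rfl⟩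

/-- In the ell-quotient, elements of `Δ^tp_X` commute. [folklore] -/
private theorem toEll_mul_comm_of_mem_delta' (D : ThetaSetting p) {x y : D.PiTemp} (hx : x ∈ D.DeltaTemp)
    (hy : y ∈ D.DeltaTemp) : toEll D x * toEll D y = toEll D y * toEll D x := by
  have h := toEll_commutator_eq_one_of_mem_delta D hx hy
  rw [map_mul, map_mul, map_mul, map_inv, map_inv, mul_inv_eq_one, mul_inv_eq_iff_eq_mul] at h
  exact h

/-! ### 3. `IsTateOrigin` FAILS whenever an odd prime divides the shear exponent -/

/-- **THE CORE OF SHEAR RIGIDITY.** Let `N ∣ j` and suppose the level-`N` Galois input: for every primitive `N`-th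
root of unity `ζ` and every `N`-th root `r` of `p²` some `σ ∈ G_{ℚ_p}` fixes `ζ` and moves `r`. Then the
print-faithful Tate-module clause FAILS at `ThetaSetting.modelχq p i j hj` (at level `N`: the commutator of the lift of
`1 ∈ Z` with such a `σ` is `κ_p(σ)^j ≡ 0 (N)` in `(Δ^tp_Y)^ell/N`, while clause (c) wants it to be the NON-trivial
Kummer class `σ r / r`). [cite: MochizukiEtTh2009, §1 p.13] -/
theorem modelχq_not_isTateOrigin_of_dvd_of_gal (N : ℕ+) (hNj : ((N : ℕ) : ℤ) ∣ j)
    (hgal : ∀ ζ r : PadicAlgCl p, IsPrimitiveRoot ζ (N : ℕ) → r ^ (N : ℕ) = ((p : ℕ) : PadicAlgCl p) ^ 2 →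
      ∃ σ : GQp p, σ ζ = ζ ∧ σ r ≠ r) :
    ¬ (ThetaSetting.modelχq p i j hj).IsTateOrigin := by
  intro h
  set D := ThetaSetting.modelχq p i j hj with hD
  obtain ⟨y₁, z, ζ, r, -, hz, hzZ, hζ, hr, -, hord, htw, hkum⟩ := h.tate N
  have hp0 : ((p : ℕ) : PadicAlgCl p) ≠ 0 := Nat.cast_ne_zero.mpr (Fact.out : p.Prime).ne_zero
  have hr' : r ^ (N : ℕ) = ((p : ℕ) : PadicAlgCl p) ^ 2 := hr
  have hr0 : r ≠ 0 := by
    rintro rfl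
    rw [zero_pow N.ne_zero] at hr'
    exact pow_ne_zero 2 hp0 hr'.symm
  haveI : NeZero (N : ℕ) := ⟨N.ne_zero⟩
  obtain ⟨σ, hσζ, hσr⟩ := hgal ζ r hζ hr'
  -- `σ r / r` is a `q`-th root of unity, hence a power of the primitive `ζ`
  have hroot : (σ r / r) ^ (N : ℕ) = 1 := by
    rw [div_pow, ← map_pow, hr', map_pow, map_natCast, div_self (pow_ne_zero 2 hp0)]
  obtain ⟨m, hmq, hm⟩ := hζ.eq_pow_of_pow_eq_one hroot
  have hσr' : σ r = ζ ^ m * r := by rw [hm, div_mul_cancel₀ _ hr0]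
  -- the Galois element in `Π^tp_X`, the lift `z_a = inl(η a, 1)` of `1 ∈ Z`, and its twist defect `w`
  let g : D.PiTemp := (SemidirectProduct.inr σ : PiTpχq p i j)
  let aG : Gfp := ⟨(eta (FreeGroup.of 0), Multiplicative.ofAdd (1 : ℤ)), eta_a_mem_Gfpq⟩
  let za : D.PiTemp := (SemidirectProduct.inl aG : PiTpχq p i j)
  let w : D.PiTemp := (SemidirectProduct.inl (aG⁻¹ * actχq p i j σ aG) : PiTpχq p i j)
  have hgza : g * za * g⁻¹ = za * w := by
    change (SemidirectProduct.inr σ : PiTpχq p i j) * SemidirectProduct.inl aG * (SemidirectProduct.inr σ)⁻¹ =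
      SemidirectProduct.inl aG * SemidirectProduct.inl (aG⁻¹ * actχq p i j σ aG)
    rw [← map_inv, ← SemidirectProduct.inl_aut, ← map_mul, mul_inv_cancel_left]
  have hw_delta : w ∈ D.DeltaTemp := (mem_deltaTempχq_iff p i j _).mpr (SemidirectProduct.right_inl _)
  -- `w^ell ∈ q·(Δ^tp_Y)^ell`: `ê(w) = 1` and `ê_b(w) = κ_p(σ)^j ≡ 0 (q)` because `q ∣ j`
  have hw_ell : toEll D w ∈ ellPowersY D N := by
    refine toEll_inl_mem_ellPowersYj p i j hj N ?_ ?_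
    · rw [map_mul, map_inv, map_mul, map_inv, eHat_gfpFst_actχq_eta_a, gfpFst_apply]
      change (eHat (eta (FreeGroup.of 0)))⁻¹ * _ = 1
      rw [eHat_eta, expA_apply, heisHom_of_zero, inv_mul_cancel]
    · rw [map_mul, map_inv, map_mul, map_inv, map_mul, map_inv, eHatB_gfpFst_actχq_eta_a, gfpFst_apply]
      change (ZHatLevel.level N (eHatB (eta (FreeGroup.of 0))))⁻¹ * _ = 1
      rw [eHatB_eta_of_zero, map_one, inv_one, one_mul, map_zpow]
      obtain ⟨t, ht⟩ := hNj
      have hxq : ∀ x : Multiplicative (ZMod N), x ^ (N : ℕ) = 1 := fun x => by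
        rw [← ofAdd_toAdd x, ← ofAdd_nsmul, nsmul_eq_mul, ZMod.natCast_self, zero_mul]
        rfl
      rw [ht, zpow_mul, zpow_natCast, hxq, one_zpow]
  -- the decomposition `z = z_a · y₀` with `y₀ ∈ Δ^tp_Y`
  have hza_delta : za ∈ D.DeltaTemp := (mem_deltaTempχq_iff p i j _).mpr (SemidirectProduct.right_inl _)
  have hza_Z : D.toZ za = Multiplicative.ofAdd 1 := by
    change (tateTwistData₀ p i j).toZ _ = _
    rw [GfpTwistData₀.toZ_apply, SemidirectProduct.left_inl, gfpSnd_apply]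
  let y₀ : D.PiTemp := za⁻¹ * z
  have hy₀_delta : y₀ ∈ D.DeltaTemp := D.DeltaTemp.mul_mem (D.DeltaTemp.inv_mem hza_delta) hz
  have hy₀_Y : y₀ ∈ D.GtpY := by
    change y₀ ∈ D.toZ.ker
    rw [MonoidHom.mem_ker, map_mul, map_inv, hza_Z, hzZ, inv_mul_cancel]
  have hy₀ : y₀ ∈ D.DtpY := Subgroup.mem_inf.mpr ⟨hy₀_Y, hy₀_delta⟩
  have hz_eq : z = za * y₀ := by rw [mul_inv_cancel_left]
  -- the aug-values of `g`
  have haug : ∀ x : PadicAlgCl p, D.aug g x = σ x := fun x => rfl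
  have haugζ : D.aug g ζ = ζ ^ 1 := by rw [haug, pow_one, hσζ]
  have haugr : D.aug g r = ζ ^ m * r := by rw [haug, hσr']
  -- the commutator `[g, z]` in the ell-quotient
  have hgy₀_delta : g * y₀ * g⁻¹ ∈ D.DeltaTemp := (deltaTemp_normal D).conj_mem _ hy₀_delta g
  have hkey : toEll D (g * z * g⁻¹ * z⁻¹) = toEll D w * (toEll D (g * y₀ * g⁻¹) * (toEll D y₀)⁻¹) := by
    have hc : g * z * g⁻¹ * z⁻¹ = za * (w * ((g * y₀ * g⁻¹) * y₀⁻¹)) * za⁻¹ := by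
      rw [hz_eq, mul_inv_rev]
      calc g * (za * y₀) * g⁻¹ * (y₀⁻¹ * za⁻¹)
          = (g * za * g⁻¹) * (g * y₀ * g⁻¹) * y₀⁻¹ * za⁻¹ := by group
        _ = za * w * (g * y₀ * g⁻¹) * y₀⁻¹ * za⁻¹ := by rw [hgza]
        _ = za * (w * ((g * y₀ * g⁻¹) * y₀⁻¹)) * za⁻¹ := by group
    rw [hc, map_mul, map_mul, toEll_mul_comm_of_mem_delta' p D hza_delta
      (D.DeltaTemp.mul_mem hw_delta (D.DeltaTemp.mul_mem hgy₀_delta (D.DeltaTemp.inv_mem hy₀_delta))),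
      map_inv, mul_assoc, mul_inv_cancel, mul_one, map_mul, map_mul, map_inv]
  -- clause (b) with `k = 1`, clause (c), and the order clause (a′)
  have hb := htw g 1 haugζ y₀ hy₀
  rw [pow_one] at hb
  have hc := hkum g m haugr
  rw [hkey] at hc
  have hmem : toEll D y₁ ^ m ∈ ellPowersY D N := by
    have h1 := (ellPowersY D N).mul_mem hw_ell hb
    have := (ellPowersY D N).mul_mem ((ellPowersY D N).inv_mem h1) hc
    rwa [inv_mul_cancel_left, inv_mem_iff] at this
  rw [hord m] at hmem
  have hm0 : m = 0 := Nat.eq_zero_of_dvd_of_lt hmem hmq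
  exact hσr (by rw [hσr', hm0, pow_zero, one_mul])

/-- **SHEAR RIGIDITY at an odd prime.** If an odd prime `q` divides the shear exponent `j`, the print-faithful
Tate-module clause FAILS at `ThetaSetting.modelχq p i j hj` (level `N = q`, Galois input
`exists_gal_fix_zeta_move_primeRoot`). [cite: MochizukiEtTh2009, §1 p.13] -/
theorem modelχq_not_isTateOrigin_of_prime_dvd {q : ℕ} (hq : q.Prime) (hq2 : q ≠ 2) (hqj : (q : ℤ) ∣ j) :
    ¬ (ThetaSetting.modelχq p i j hj).IsTateOrigin :=
  modelχq_not_isTateOrigin_of_dvd_of_gal p i j hj ⟨q, hq.pos⟩ hqj fun _ _ hζ hr =>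
    exists_gal_fix_zeta_move_primeRoot p hq hq2 hζ hr

/-! ### 4. Consequences -/

/-- **The UNSHEARED inner-twisted models fail** (`j = 0`, every inner exponent `i`; `3 ∣ 0`): the stage-1 failure
`SettingModelChiOriginProfile.modelχ_not_isTateOrigin` persists under `Inn(b^{κ_p^i})`. [cite: MochizukiEtTh2009, §1 p.13] -/
theorem modelχq_zero_not_isTateOrigin (i : ℤ) : ¬ (ThetaSetting.modelχq p i 0 Even.zero).IsTateOrigin :=
  modelχq_not_isTateOrigin_of_prime_dvd p i 0 Even.zero Nat.prime_three (by decide) (dvd_zero _)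

/-- If `IsTateOrigin` holds at `modelχq p i j`, every prime factor of `j` is `2`. [cite: MochizukiEtTh2009, §1 p.13] -/
theorem eq_two_of_prime_dvd_of_isTateOrigin (h : (ThetaSetting.modelχq p i j hj).IsTateOrigin) {q : ℕ}
    (hq : q.Prime) (hqj : (q : ℤ) ∣ j) : q = 2 := by
  by_contra hq2
  exact modelχq_not_isTateOrigin_of_prime_dvd p i j hj hq hq2 hqj h

/-- If `IsTateOrigin` holds at `modelχq p i j`, then `j ≠ 0`. [cite: MochizukiEtTh2009, §1 p.13] -/
theorem ne_zero_of_isTateOrigin (h : (ThetaSetting.modelχq p i j hj).IsTateOrigin) : j ≠ 0 := by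
  rintro rfl
  exact modelχq_not_isTateOrigin_of_prime_dvd p i 0 hj Nat.prime_three (by decide) (dvd_zero _) h

/-- **`IsTateOrigin ⇒ |j| = 2^a` with `a ≥ 1`**: the shear exponent is a signed power of `2`
(`j = ±2` is the designated instance; `±4, ±8, …` await the level-`4` Galois input). [cite: MochizukiEtTh2009, §1 p.13] -/
theorem natAbs_eq_two_pow_of_isTateOrigin (h : (ThetaSetting.modelχq p i j hj).IsTateOrigin) :
    ∃ a : ℕ, 0 < a ∧ j.natAbs = 2 ^ a := by
  have hj0 : j.natAbs ≠ 0 := Int.natAbs_ne_zero.mpr (ne_zero_of_isTateOrigin p i j hj h)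
  have hall : ∀ {d : ℕ}, d.Prime → d ∣ j.natAbs → d = 2 := fun hd hdj =>
    eq_two_of_prime_dvd_of_isTateOrigin p i j hj h hd (Int.ofNat_dvd_left.mpr hdj)
  have ha : j.natAbs = 2 ^ j.natAbs.primeFactorsList.length := Nat.eq_prime_pow_of_unique_prime_dvd hj0 hall
  refine ⟨j.natAbs.primeFactorsList.length, Nat.pos_of_ne_zero ?_, ha⟩
  intro ha0
  have h2 : 2 ∣ j.natAbs := even_iff_two_dvd.mp (Int.natAbs_even.mpr hj)
  rw [ha, ha0, pow_zero] at h2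
  exact absurd h2 (by norm_num)

/-- **Summary (NV register).** The Tate-module clause at the stage-2 family `modelχq p i j`: HOLDS at the designated
shear `j = 2` (every `i`), FAILS at `j = 0` (every `i`) and whenever an odd prime divides `j`.
[cite: MochizukiEtTh2009, §1 p.13] -/
theorem modelχq_isTateOrigin_two_and_rigidity :
    (∀ i : ℤ, (ThetaSetting.modelχq p i 2 even_two).IsTateOrigin) ∧
      (∀ i : ℤ, ¬ (ThetaSetting.modelχq p i 0 Even.zero).IsTateOrigin) ∧
      (∀ (i j : ℤ) (hj : Even j) (q : ℕ), q.Prime → q ≠ 2 → (q : ℤ) ∣ j →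
        ¬ (ThetaSetting.modelχq p i j hj).IsTateOrigin) :=
  ⟨modelχq_isTateOrigin p, modelχq_zero_not_isTateOrigin p,
    fun i j hj _ hq hq2 hqj => modelχq_not_isTateOrigin_of_prime_dvd p i j hj hq hq2 hqj⟩

end Model

end Literature.AnabelianGeometry.EtaleTheta.SettingModel

end
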